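import Literature.AnabelianGeometry.EtaleTheta.Discharge.Sec5ConstantsDictionaryAtBaseFieldHull
import Literature.AnabelianGeometry.EtaleTheta.Discharge.Sec5Thm510iiiOfThetaSettingYddOfDeltaCharacteristic
import HarnessLib

/-!
# [EtTh] Theorem 5.10 (ii) ∧ (iii) pp.333–335 (PDF pp.107–109) — the `_canonical` END forms FIRED at the base-field-theoretic hull of a theta setting
# (proof-only corollary of the `ConstantsDictionary` knit (β1))

S. Mochizuki, *The étale theta function and its Frobenioid-theoretic manifestations*, Publ. RIMS **45** (2009) [MochizukiEtTh2009], Theorem 5.10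
p.333 (PDF p.107): «(ii) `Ψ` preserves `μ_N(B_N) ⊆ E_N ⊆ E^Π_N[B_N]`.  (iii) `Ψ` induces an isomorphism of mono-theta environments `𝕄(C̲) ⥲ 𝕄(C̲)` …»; proof
of (iii) p.335 (PDF p.109): «up to composition with an automorphism of the topological group `Π^tp_Ÿ̲` that extends to an automorphism of the topological group
`Π^tp_X` …».  [cite: MochizukiEtTh2009, Thm 5.10 (ii)(iii) p.333–335 (PDF pp.107–109)]

abc-iut cell, layer L2 = [EtTh], seat abc-iut-f-142 (gen 12); row (β2) «THM 5.10 (ii)∧(iii) END FORMS FIRED AT THE HULL», the second consumer of the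
(β1) «DICTIONARY KNIT (d) AT THE HULL» (FILE 1 ★ p530309 `EtaleTheta/ConstantsReadingOfBaseFieldHull`, FILE 2 ★ p545647
`Discharge/Sec5ConstantsDictionaryAtBaseFieldHull`; first consumer = the Lemma 5.8 node ★ p548635 `Discharge/Sec5Lem58NodeAtBaseFieldHull`).  PROOF-ONLY
(class (a): 0 `def` / 0 instance / 0 notation / 0 `Prop`-valued definition / 0 sorry; nothing landed is edited or restated): abc-iut-w6-d053's `_canonical`
END forms of record for NODES rows `EtTh:Thm5.10(ii)` / `EtTh:Thm5.10(iii)` (`Discharge/Sec5Thm510iiiOfThetaSettingYddOfDeltaCharacteristic.lean`, p492406: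
`thm510_ii_iii_ofThetaSettingYdd_of_repDelta_canonical` / `…_of_isTopCharacteristic_canonical`; residual of record RECLOSED-MOD-STRUCTURAL {`hψΔ`} ∪
{junction data over the model, `hconst`, `hD`, `m`, transports, `ψY`}) INSTANTIATED at the ONE carrier where the tree constructs the K4 column
{`hconst`, `m`, `hD`}: the §5 data `ofThetaSettingData` of the Setting over abc-iut-L2-d3's base-field-theoretic hull `BsFldHull.temperedFrobenioid p C.augHuu …`
with `A_⊙^bs := Ÿ̲̲` (`BiKummerSetting.mkOfThetaSettingYdd` = `hullSetting`, `hullSetting_eq`; L2-lead R1112 carrier of record), `K := D.K`, «the natural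
inclusion `K^× → O^×(B_N^birat)`» := `BsFldHull.constEmb` — with `hconst := BsFldHull.biratAutModel_constEmb` (p506755, a THEOREM), `m := BsFldHull.muReadingEquiv`
(FILE 1 ★ p530309) and `hD := constantsDictionary_hull` (FILE 2 ★ p545647), exactly as ★ p548635 did for the Lemma 5.8 node.
* **`ThetaFrobenioid.thm510_ii_iii_hull_of_repDelta`** — `PsiAutPreserves Ψ β ΨbiratAut ∧ MonoThetaEnvCompat …` (Theorem 5.10 (ii) ∧ (iii) as typed by
  abc-iut-L2-t4 / abc-iut-L2-t11) for `F :=` the §5 data of the Setting over the hull; residual ∀-binders EXACTLY {junction data of the hull (`Rq Sq NH pullFrac θ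
  Bl Pl Rl Rt Q hinvc hinvp`; Setting side `e μ hC hS`), `K₀ ⊇ K` (`hK₀`), `hsat` := the Def. 5.4 fixing slot at `B_N` (`a(U_{B_N}) ≤ Gal(ℚ̄_p/E_N(K₀))`, p527685),
  Thm. 5.7 / Thm. 4.4 (iv) AS TYPED (the transports `Ψ β ΨbiratAut Ψbs eΨ hsq hΨconst αA eA Dc Dp hRT θA hST hθY hθYdd` — print's own inputs BY NAME, L2-lead
  R984), the representative `ψY` (`hbase hψY hψYdd`), and the ONE clause `hψΔ`} — NO `hconst`, NO `m`, NO `hD`, NO F-0620 / `h15` / `L`.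
* **`ThetaFrobenioid.thm510_ii_iii_hull_of_isTopCharacteristic`** — the same from «`Δ^tp_X̲̲ ⊆ Π^tp_X̲̲` characteristic» (`hΔX : IsTopCharacteristic C.Huu
  (D.DeltaTemp.subgroupOf C.Huu)`, [EtTh] Def. 3.3 (i); producers of record named in p492406: F-0007 [AbsAnab] Lem. 1.3.8 BY NAME, `hextΔ` ([EtTh] Prop. 2.4 shape,
  `isTopCharacteristic_deltaTemp_subgroupOf_Huu_of_extends`), the stage-2 Tate models) in place of `hψΔ`.
STATEMENT SHAPE (numbers, not adjectives): each statement `let`-binds SIX names ONCE — `F :=` the §5 data of the Setting over the hull, the K4 column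
`hconst` / `m` / `hD` := the three (β1)-side theorems above, `H := facts_ofThetaSettingYddData_of_constantsDictionary … hconst m hD` (abc-iut-L2-t11, the `Facts`
bundle ⟸ {`hconst`, `hD`}, p440765) and `DK := dkOfConnectedTemperoidData … hconst (kxRootNModCyclotome_ofThetaSettingData_of_constantsDictionary … hconst m hD)` (the
honest `K^×`-part) — and then displays the 21 (resp. 1 + 20) binders and the conclusion of p492406 VERBATIM over these names (p492406 writes the same `Facts` /
`DK` terms inline).  Measured on the farm: the fully longhand display exhausts 800 000 heartbeats at the 13th binder (`whnf`); with `F` alone `let`-bound the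
conclusion's inline `Facts` ×4 / `DK` terms cost ≈ 160 s and > 800 000 heartbeats per declaration; the six-`let` form elaborates within the DEFAULT-×4 budget
`set_option maxHeartbeats 800000` in ≈ 125 s per declaration (variable block + `F` + all binders ≈ 11 s; bare application of the generic END form ≈ 45 s) — the
mixed `Γ`-typing `↥C.Huu` / `(C.temperedArithmeticGroup e).Pi` of hull-of-the-Setting statements, FILE 2's design note.  The proofs `intro` the six `let`s and apply
the generic END forms argument-wise to them.
HONEST FRAMING: the carrier has GENUINE base `B^temp(Π^tp_X̲̲)⁰`, genuine constants `K ⊆ ℚ̄_p` and genuine Galois action but DEGENERATE divisor geometry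
(every rational function is a constant; abc-iut-L2-d3's label) — a discharge of the K4 column {`hconst`, `m`, `hD`} of the typed node AT THIS CARRIER modulo the
slot `hsat`, with the transports, `ψY` and `hψΔ`/`hΔX` DISPLAYED, NOT [EtTh] Theorem 5.10 for the tempered Frobenioid of a Tate curve (which enters the tree only as
the abstract parameter `tf`); at abc-iut-L2-t9's `temperedFrobenioidSmall` no such dictionary exists (p499346).  Whether NODES rows 192/193 move is the L2 chair's
census call, not this file's.  Nothing of [EtTh] (a refereed paper) is asserted unconditionally; typed ≠ proved; discharged-at-our-data ≠ endorsed; nothing here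
bears on [IUTchIII] Cor. 3.12; no side taken; nothing here asserts abc proved or refuted.
-/

noncomputable section

namespace Literature.AnabelianGeometry.EtaleTheta

open CategoryTheory Opposite Literature.AlgebraicGeometry.Frobenioids Literature.AnabelianGeometry.SemiGraphs
  Literature.AnabelianGeometry.SemiGraphs.GaloisObjects Literature.AlgebraicGeometry.Frobenioids.QuasiTemperoid.BTempConnected

namespace ThetaFrobenioid

section HullThm510

variable {p : ℕ} [Fact p.Prime] {D : ThetaSetting p} {E : D.EtaleThetaData} {l : ℕ} {C : E.DoubleUnderline l}
  {e : D.toTemperedCurve.GroupLevelData} {N : ℕ+} (μ : D.CyclotomeMod l N) (hC : D.Compat) (hS : D.Sec2Hyps)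
  {Rq Sq : ((ConnectedPart (BTemp (C.temperedArithmeticGroup e).Pi))ᵒᵖ ⥤ CommMonCat.{0}) → Prop}
  {NH : Subgroup (Field.absoluteGaloisGroup D.K) → (BsFldHull.temperedFrobenioid p C.augHuu (C.isOpen_map_augHuu e) (C.temperedArithmeticGroup e).isTempered Rq Sq).category → ℕ+ → Prop}
  {pullFrac : ∀ {A A' : (BiKummerSetting.mkOfThetaSettingYdd C e μ hC hS (BsFldHull.temperedFrobenioid p C.augHuu (C.isOpen_map_augHuu e) (C.temperedArithmeticGroup e).isTempered Rq Sq) (BsFldHull.temperedFrobenioid_monoidType p C.augHuu (C.isOpen_map_augHuu e) (C.temperedArithmeticGroup e).isTempered Rq Sq) (BsFldHull.hP p C.augHuu (C.isOpen_map_augHuu e) (C.temperedArithmeticGroup e).isTempered Rq Sq) NH).C} (_ : A' ⟶ A), (BiKummerSetting.mkOfThetaSettingYdd C e μ hC hS (BsFldHull.temperedFrobenioid p C.augHuu (C.isOpen_map_augHuu e) (C.temperedArithmeticGroup e).isTempered Rq Sq) (BsFldHull.temperedFrobenioid_monoidType p C.augHuu (C.isOpen_map_augHuu e) (C.temperedArithmeticGroup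 e).isTempered Rq Sq) (BsFldHull.hP p C.augHuu (C.isOpen_map_augHuu e) (C.temperedArithmeticGroup e).isTempered Rq Sq) NH).biratUnits A → (BiKummerSetting.mkOfThetaSettingYdd C e μ hC hS (BsFldHull.temperedFrobenioid p C.augHuu (C.isOpen_map_augHuu e) (C.temperedArithmeticGroup e).isTempered Rq Sq) (BsFldHull.temperedFrobenioid_monoidType p C.augHuu (C.isOpen_map_augHuu e) (C.temperedArithmeticGroup e).isTempered Rq Sq) (BsFldHull.hP p C.augHuu (C.isOpen_map_augHuu e) (C.temperedArithmeticGroup e).isTempered Rq Sq) NH).biratUnits A'}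
  {θ : (BiKummerSetting.mkOfThetaSettingYdd C e μ hC hS (BsFldHull.temperedFrobenioid p C.augHuu (C.isOpen_map_augHuu e) (C.temperedArithmeticGroup e).isTempered Rq Sq) (BsFldHull.temperedFrobenioid_monoidType p C.augHuu (C.isOpen_map_augHuu e) (C.temperedArithmeticGroup e).isTempered Rq Sq) (BsFldHull.hP p C.augHuu (C.isOpen_map_augHuu e) (C.temperedArithmeticGroup e).isTempered Rq Sq) NH).biratUnits (BiKummerSetting.mkOfThetaSettingYdd C e μ hC hS (BsFldHull.temperedFrobenioid p C.augHuu (C.isOpen_map_augHuu e) (C.temperedArithmeticGroup e).isTempered Rq Sq) (BsFldHull.temperedFrobenioid_monoidType p C.augHuu (C.isOpen_map_augHuu e) (C.temperedArithmeticGroup e).isTempered Rq Sq) (BsFldHull.hP p C.augHuu (C.isOpen_map_augHuu e) (C.temperedArithmeticGroup e).isTempered Rq Sq) NH).Aodot}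
  {Bl : (BiKummerSetting.mkOfThetaSettingYdd C e μ hC hS (BsFldHull.temperedFrobenioid p C.augHuu (C.isOpen_map_augHuu e) (C.temperedArithmeticGroup e).isTempered Rq Sq) (BsFldHull.temperedFrobenioid_monoidType p C.augHuu (C.isOpen_map_augHuu e) (C.temperedArithmeticGroup e).isTempered Rq Sq) (BsFldHull.hP p C.augHuu (C.isOpen_map_augHuu e) (C.temperedArithmeticGroup e).isTempered Rq Sq) NH).C}
  {Pl : (BiKummerSetting.mkOfThetaSettingYdd C e μ hC hS (BsFldHull.temperedFrobenioid p C.augHuu (C.isOpen_map_augHuu e) (C.temperedArithmeticGroup e).isTempered Rq Sq) (BsFldHull.temperedFrobenioid_monoidType p C.augHuu (C.isOpen_map_augHuu e) (C.temperedArithmeticGroup e).isTempered Rq Sq) (BsFldHull.hP p C.augHuu (C.isOpen_map_augHuu e) (C.temperedArithmeticGroup e).isTempered Rq Sq) NH).FractionPair θ Bl}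
  {Rl : (BiKummerSetting.mkOfThetaSettingYdd C e μ hC hS (BsFldHull.temperedFrobenioid p C.augHuu (C.isOpen_map_augHuu e) (C.temperedArithmeticGroup e).isTempered Rq Sq) (BsFldHull.temperedFrobenioid_monoidType p C.augHuu (C.isOpen_map_augHuu e) (C.temperedArithmeticGroup e).isTempered Rq Sq) (BsFldHull.hP p C.augHuu (C.isOpen_map_augHuu e) (C.temperedArithmeticGroup e).isTempered Rq Sq) NH).NthRoot θ Pl C.lPNat pullFrac}
  (Q : FrobenioidTheta.ThetaSubquotientStub.{0} (ConnectedPart (BTemp (C.temperedArithmeticGroup e).Pi)))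
  (Rt : (BiKummerSetting.mkOfThetaSettingYdd C e μ hC hS (BsFldHull.temperedFrobenioid p C.augHuu (C.isOpen_map_augHuu e) (C.temperedArithmeticGroup e).isTempered Rq Sq) (BsFldHull.temperedFrobenioid_monoidType p C.augHuu (C.isOpen_map_augHuu e) (C.temperedArithmeticGroup e).isTempered Rq Sq) (BsFldHull.hP p C.augHuu (C.isOpen_map_augHuu e) (C.temperedArithmeticGroup e).isTempered Rq Sq) NH).NthRoot Rl.root Rl.pair N pullFrac)
  (hinvc : ∀ g : Aut Rt.AN.base,
    pull (BsFldHull.temperedFrobenioid p C.augHuu (C.isOpen_map_augHuu e) (C.temperedArithmeticGroup e).isTempered Rq Sq).divisorMonoid g.hom (ModelFrobenioid.div Rt.pair.num) = ModelFrobenioid.div Rt.pair.num)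
  (hinvp : ∀ y : (C.thetaEnvData μ hC hS).PiX, y ∈ (C.thetaEnvData μ hC hS).PiYdd →
    pull (BsFldHull.temperedFrobenioid p C.augHuu (C.isOpen_map_augHuu e) (C.temperedArithmeticGroup e).isTempered Rq Sq).divisorMonoid ((BiKummerSetting.mkOfThetaSettingYdd C e μ hC hS (BsFldHull.temperedFrobenioid p C.augHuu (C.isOpen_map_augHuu e) (C.temperedArithmeticGroup e).isTempered Rq Sq) (BsFldHull.temperedFrobenioid_monoidType p C.augHuu (C.isOpen_map_augHuu e) (C.temperedArithmeticGroup e).isTempered Rq Sq) (BsFldHull.hP p C.augHuu (C.isOpen_map_augHuu e) (C.temperedArithmeticGroup e).isTempered Rq Sq) NH).galoisSurj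
      Rt.AN.base Rt.αData.isGalois ((ContinuousMulEquiv.refl _) y)).hom (ModelFrobenioid.div Rt.pair.den) = ModelFrobenioid.div Rt.pair.den)
  (K₀ : IntermediateField ℚ_[p] (PadicAlgCl p)) (hK₀ : D.K ≤ K₀)
  (hsat : (((CosetCat.equivConnectedPart (C.temperedArithmeticGroup e).isTempered).inverse.obj Rt.BN.base).sg.toSubgroup.map C.augHuu :
      Subgroup (GQp p)) ≤
    (IntermediateField.normalClosure ℚ_[p]
      (IntermediateField.adjoin ℚ_[p] ((K₀ : Set (PadicAlgCl p)) ∪ {x | x ^ (N : ℕ) ∈ K₀})) (PadicAlgCl p)).fixingSubgroup)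

include hK₀ hsat in
set_option maxHeartbeats 800000 in
/-- **[EtTh] Theorem 5.10 (ii) ∧ (iii) — the `_canonical` END form FIRED at the base-field-theoretic hull of the Setting, from ONE clause `hψΔ`**
(«the representative `ψY` carries `Δ^tp_X̲̲` onto itself»): abc-iut-w6-d053's `thm510_ii_iii_ofThetaSettingYdd_of_repDelta_canonical` (p492406) at `F :=` the §5 data
`ofThetaSettingData μ hC hS …` of the Setting over `mkOfThetaSettingYdd C e μ hC hS (BsFldHull.temperedFrobenioid p C.augHuu …) …` with `K := D.K`,
`constEmb := BsFldHull.constEmb`, its K4 column SUPPLIED BY NAME: `hconst := BsFldHull.biratAutModel_constEmb` (p506755), `m := BsFldHull.muReadingEquiv` (p530309),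
`hD := constantsDictionary_hull` (p545647) — the statement's `let`s `hconst` / `m` / `hD`, with `H` (the `Facts` bundle) and `DK` (the honest `K^×`-part) built from
them exactly as p492406 does inline (six `let`s: display budget, module docstring); residual ∀-binders EXACTLY {junction data of the hull, `K₀ ⊇ K`,
the Def. 5.4 slot `hsat`, Thm. 5.7 / Thm. 4.4 (iv) AS TYPED (the transports), the representative `ψY`, `hψΔ`}.  HONEST: degenerate divisor geometry at this carrier; a
discharge at OUR carrier, not print's tempered Frobenioid of a curve; no side taken on [IUTchIII] Cor. 3.12; typed ≠ proved.
[cite: MochizukiEtTh2009, Thm 5.10 (ii)(iii) p.333–335 (PDF pp.107–109); Thm 5.7 p.329 (PDF p.103); Thm 4.4 (iv) p.320 (PDF p.94); Def 5.4 p.327 (PDF p.101)] -/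
theorem thm510_ii_iii_hull_of_repDelta :
    let F := ofThetaSettingData μ hC hS (BsFldHull.hypotheses p C.augHuu (C.isOpen_map_augHuu e) (C.temperedArithmeticGroup e).isTempered Rq Sq) Q Rt (D.K)
      (BsFldHull.constEmb p C.augHuu (C.isOpen_map_augHuu e) D.K augHuu_mem_fixingSubgroup (C.temperedArithmeticGroup e).isTempered Rq Sq Rt.BN)
      (BsFldHull.constEmb_injective p C.augHuu (C.isOpen_map_augHuu e) D.K augHuu_mem_fixingSubgroup (C.temperedArithmeticGroup e).isTempered Rq Sq Rt.BN) hinvc hinvp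
    let hconst := BsFldHull.biratAutModel_constEmb p C.augHuu (C.isOpen_map_augHuu e) D.K augHuu_mem_fixingSubgroup (C.temperedArithmeticGroup e).isTempered Rq Sq Rt.BN
    let m := BsFldHull.muReadingEquiv (T := C.thetaEnvData μ hC hS) p Rt (BsFldHull.hypotheses p C.augHuu (C.isOpen_map_augHuu e) (C.temperedArithmeticGroup e).isTempered Rq Sq) Q C.odd_lPNat (ContinuousMulEquiv.refl _) (D.K)
      (BsFldHull.constEmb p C.augHuu (C.isOpen_map_augHuu e) D.K augHuu_mem_fixingSubgroup (C.temperedArithmeticGroup e).isTempered Rq Sq Rt.BN)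
      (BsFldHull.constEmb_injective p C.augHuu (C.isOpen_map_augHuu e) D.K augHuu_mem_fixingSubgroup (C.temperedArithmeticGroup e).isTempered Rq Sq Rt.BN) hinvc hinvp (hμN_of_fixingSlot Rt K₀ hsat)
    let hD := constantsDictionary_hull μ hC hS Q Rt hinvc hinvp K₀ hK₀ hsat
    let H := facts_ofThetaSettingYddData_of_constantsDictionary μ hC hS (BsFldHull.hypotheses p C.augHuu (C.isOpen_map_augHuu e) (C.temperedArithmeticGroup e).isTempered Rq Sq) Q (D.K) Rt
      (BsFldHull.constEmb p C.augHuu (C.isOpen_map_augHuu e) D.K augHuu_mem_fixingSubgroup (C.temperedArithmeticGroup e).isTempered Rq Sq Rt.BN)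
      (BsFldHull.constEmb_injective p C.augHuu (C.isOpen_map_augHuu e) D.K augHuu_mem_fixingSubgroup (C.temperedArithmeticGroup e).isTempered Rq Sq Rt.BN) hinvc hinvp hconst m hD
    let DK := dkOfConnectedTemperoidData (T := C.thetaEnvData μ hC hS) (BsFldHull.hypotheses p C.augHuu (C.isOpen_map_augHuu e) (C.temperedArithmeticGroup e).isTempered Rq Sq) Q C.odd_lPNat Rt (ContinuousMulEquiv.refl _) (D.K)
      (BsFldHull.constEmb p C.augHuu (C.isOpen_map_augHuu e) D.K augHuu_mem_fixingSubgroup (C.temperedArithmeticGroup e).isTempered Rq Sq Rt.BN)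
      (BsFldHull.constEmb_injective p C.augHuu (C.isOpen_map_augHuu e) D.K augHuu_mem_fixingSubgroup (C.temperedArithmeticGroup e).isTempered Rq Sq Rt.BN) hinvc hinvp hconst
      (kxRootNModCyclotome_ofThetaSettingData_of_constantsDictionary μ hC hS (BsFldHull.hypotheses p C.augHuu (C.isOpen_map_augHuu e) (C.temperedArithmeticGroup e).isTempered Rq Sq) Q Rt (D.K)
        (BsFldHull.constEmb p C.augHuu (C.isOpen_map_augHuu e) D.K augHuu_mem_fixingSubgroup (C.temperedArithmeticGroup e).isTempered Rq Sq Rt.BN)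
        (BsFldHull.constEmb_injective p C.augHuu (C.isOpen_map_augHuu e) D.K augHuu_mem_fixingSubgroup (C.temperedArithmeticGroup e).isTempered Rq Sq Rt.BN) hinvc hinvp hconst m hD)
    ∀ (Ψ : (BiKummerSetting.mkOfThetaSettingYdd C e μ hC hS (BsFldHull.temperedFrobenioid p C.augHuu (C.isOpen_map_augHuu e) (C.temperedArithmeticGroup e).isTempered Rq Sq) (BsFldHull.temperedFrobenioid_monoidType p C.augHuu (C.isOpen_map_augHuu e) (C.temperedArithmeticGroup e).isTempered Rq Sq) (BsFldHull.hP p C.augHuu (C.isOpen_map_augHuu e) (C.temperedArithmeticGroup e).isTempered Rq Sq) NH).C ≌ (BiKummerSetting.mkOfThetaSettingYdd C e μ hC hS (BsFldHull.temperedFrobenioid p C.augHuu (C.isOpen_map_augHuu e) (C.temperedArithmeticGroup e).isTempered Rq Sq) (BsFldHull.temperedFrobenioid_monoidType p C.augHuu (C.isOpen_map_augHuu e) (C.temperedArithmeticGroup e).isTempered Rq Sq) (BsFldHull.hP p C.augHuu (C.isOpen_map_augHuu e) (C.temperedArithmeticGroup e).isTempered Rq Sq) NH).C)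
      (β : Ψ.functor.obj F.BN ≅ F.BN)
      (ΨbiratAut : F.biratUnits F.BN ≃* F.biratUnits F.BN)
      (Ψbs : ConnectedPart (BTemp (C.temperedArithmeticGroup e).Pi) ⥤ ConnectedPart (BTemp (C.temperedArithmeticGroup e).Pi))
      [Ψbs.Faithful]
      (eΨ : Ψ.functor ⋙ F.base ≅ F.base ⋙ Ψbs)
      (hsq : ∀ u : F.units F.BN,
        ∀ hu : F.psiAut Ψ β u ∈ F.units F.BN, ΨbiratAut (F.unitsToBirat F.BN u) = F.unitsToBirat F.BN ⟨_, hu⟩)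
      (hΨconst : F.constEmb.range.map ΨbiratAut.toMonoidHom = F.constEmb.range)
      (αA : Ψ.functor.obj F.AN ≅ F.AN)
      (eA : F.AN ≅ F.AN)
      (Dc Dp : Aut F.BN)
      (hRT : F.RootTransportWith Ψ αA β eA Dc Dp)
      (θA : Aut (F.base.obj F.BN) ≃* Aut (F.base.obj F.BN))
      (hST : F.StrvTransport Ψ αA eA θA)
      (hθY : F.imPiY.map θA.toMonoidHom = F.imPiY)
      (hθYdd : F.HB.map θA.toMonoidHom = F.HB)
      (ψY : F.PiX ≃ₜ* F.PiX)
      (hbase : ∀ g, F.autBase F.BN (F.psiAut Ψ β (F.sgpCap (F.ρ g))) = F.ρ (ψY g))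
      (hψY : F.PiY.map ψY.toMulEquiv.toMonoidHom = F.PiY)
      (hψYdd : F.PiYdd.map ψY.toMulEquiv.toMonoidHom = F.PiYdd)
      (hψΔ : (D.DeltaTemp.subgroupOf C.Huu).map ψY.toMulEquiv.toMonoidHom = D.DeltaTemp.subgroupOf C.Huu),
      F.PsiAutPreserves Ψ β ΨbiratAut ∧
        F.MonoThetaEnvCompat
          H.sectionsFactor
          F.outerActionLZ_of
          H.sgpCapSection
          H.sgpCupSection
          H.constantsEqNormalizer
          DK
          Ψ β ψY hbase hψY hψYdd := by
  intro F hconst m hD H DK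
  exact thm510_ii_iii_ofThetaSettingYdd_of_repDelta_canonical μ hC hS (BsFldHull.hypotheses p C.augHuu (C.isOpen_map_augHuu e) (C.temperedArithmeticGroup e).isTempered Rq Sq) Q Rt (D.K)
    (BsFldHull.constEmb p C.augHuu (C.isOpen_map_augHuu e) D.K augHuu_mem_fixingSubgroup (C.temperedArithmeticGroup e).isTempered Rq Sq Rt.BN)
    (BsFldHull.constEmb_injective p C.augHuu (C.isOpen_map_augHuu e) D.K augHuu_mem_fixingSubgroup (C.temperedArithmeticGroup e).isTempered Rq Sq Rt.BN) hinvc hinvp hconst m hD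

include hK₀ hsat in
set_option maxHeartbeats 800000 in
/-- **[EtTh] Theorem 5.10 (ii) ∧ (iii) — the `_canonical` END form FIRED at the base-field-theoretic hull of the Setting, from «`Δ^tp_X̲̲ ⊆ Π^tp_X̲̲` characteristic»**
(`hΔX : IsTopCharacteristic C.Huu (D.DeltaTemp.subgroupOf C.Huu)`, [EtTh] Def. 3.3 (i); producers of record: F-0007 [AbsAnab] Lem. 1.3.8 BY NAME, `hextΔ`, the stage-2 Tate
models): abc-iut-w6-d053's `thm510_ii_iii_ofThetaSettingYdd_of_isTopCharacteristic_canonical` (p492406) at the same six `let`s (`F`, `hconst`, `m`, `hD`, `H`, `DK`) as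
above; residual ∀-binders EXACTLY {junction data of the hull, `K₀ ⊇ K`, `hsat`, the transports, `ψY`, `hΔX`}.  HONEST: as above.
[cite: MochizukiEtTh2009, Thm 5.10 (ii)(iii) p.333–335 (PDF pp.107–109); Def 3.3 (i) p.298 (PDF p.72)] -/
theorem thm510_ii_iii_hull_of_isTopCharacteristic :
    let F := ofThetaSettingData μ hC hS (BsFldHull.hypotheses p C.augHuu (C.isOpen_map_augHuu e) (C.temperedArithmeticGroup e).isTempered Rq Sq) Q Rt (D.K)
      (BsFldHull.constEmb p C.augHuu (C.isOpen_map_augHuu e) D.K augHuu_mem_fixingSubgroup (C.temperedArithmeticGroup e).isTempered Rq Sq Rt.BN)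
      (BsFldHull.constEmb_injective p C.augHuu (C.isOpen_map_augHuu e) D.K augHuu_mem_fixingSubgroup (C.temperedArithmeticGroup e).isTempered Rq Sq Rt.BN) hinvc hinvp
    let hconst := BsFldHull.biratAutModel_constEmb p C.augHuu (C.isOpen_map_augHuu e) D.K augHuu_mem_fixingSubgroup (C.temperedArithmeticGroup e).isTempered Rq Sq Rt.BN
    let m := BsFldHull.muReadingEquiv (T := C.thetaEnvData μ hC hS) p Rt (BsFldHull.hypotheses p C.augHuu (C.isOpen_map_augHuu e) (C.temperedArithmeticGroup e).isTempered Rq Sq) Q C.odd_lPNat (ContinuousMulEquiv.refl _) (D.K)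
      (BsFldHull.constEmb p C.augHuu (C.isOpen_map_augHuu e) D.K augHuu_mem_fixingSubgroup (C.temperedArithmeticGroup e).isTempered Rq Sq Rt.BN)
      (BsFldHull.constEmb_injective p C.augHuu (C.isOpen_map_augHuu e) D.K augHuu_mem_fixingSubgroup (C.temperedArithmeticGroup e).isTempered Rq Sq Rt.BN) hinvc hinvp (hμN_of_fixingSlot Rt K₀ hsat)
    let hD := constantsDictionary_hull μ hC hS Q Rt hinvc hinvp K₀ hK₀ hsat
    let H := facts_ofThetaSettingYddData_of_constantsDictionary μ hC hS (BsFldHull.hypotheses p C.augHuu (C.isOpen_map_augHuu e) (C.temperedArithmeticGroup e).isTempered Rq Sq) Q (D.K) Rt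
      (BsFldHull.constEmb p C.augHuu (C.isOpen_map_augHuu e) D.K augHuu_mem_fixingSubgroup (C.temperedArithmeticGroup e).isTempered Rq Sq Rt.BN)
      (BsFldHull.constEmb_injective p C.augHuu (C.isOpen_map_augHuu e) D.K augHuu_mem_fixingSubgroup (C.temperedArithmeticGroup e).isTempered Rq Sq Rt.BN) hinvc hinvp hconst m hD
    let DK := dkOfConnectedTemperoidData (T := C.thetaEnvData μ hC hS) (BsFldHull.hypotheses p C.augHuu (C.isOpen_map_augHuu e) (C.temperedArithmeticGroup e).isTempered Rq Sq) Q C.odd_lPNat Rt (ContinuousMulEquiv.refl _) (D.K)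
      (BsFldHull.constEmb p C.augHuu (C.isOpen_map_augHuu e) D.K augHuu_mem_fixingSubgroup (C.temperedArithmeticGroup e).isTempered Rq Sq Rt.BN)
      (BsFldHull.constEmb_injective p C.augHuu (C.isOpen_map_augHuu e) D.K augHuu_mem_fixingSubgroup (C.temperedArithmeticGroup e).isTempered Rq Sq Rt.BN) hinvc hinvp hconst
      (kxRootNModCyclotome_ofThetaSettingData_of_constantsDictionary μ hC hS (BsFldHull.hypotheses p C.augHuu (C.isOpen_map_augHuu e) (C.temperedArithmeticGroup e).isTempered Rq Sq) Q Rt (D.K)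
        (BsFldHull.constEmb p C.augHuu (C.isOpen_map_augHuu e) D.K augHuu_mem_fixingSubgroup (C.temperedArithmeticGroup e).isTempered Rq Sq Rt.BN)
        (BsFldHull.constEmb_injective p C.augHuu (C.isOpen_map_augHuu e) D.K augHuu_mem_fixingSubgroup (C.temperedArithmeticGroup e).isTempered Rq Sq Rt.BN) hinvc hinvp hconst m hD)
    ∀ (hΔX : IsTopCharacteristic C.Huu (D.DeltaTemp.subgroupOf C.Huu))
      (Ψ : (BiKummerSetting.mkOfThetaSettingYdd C e μ hC hS (BsFldHull.temperedFrobenioid p C.augHuu (C.isOpen_map_augHuu e) (C.temperedArithmeticGroup e).isTempered Rq Sq) (BsFldHull.temperedFrobenioid_monoidType p C.augHuu (C.isOpen_map_augHuu e) (C.temperedArithmeticGroup e).isTempered Rq Sq) (BsFldHull.hP p C.augHuu (C.isOpen_map_augHuu e) (C.temperedArithmeticGroup e).isTempered Rq Sq) NH).C ≌ (BiKummerSetting.mkOfThetaSettingYdd C e μ hC hS (BsFldHull.temperedFrobenioid p C.augHuu (C.isOpen_map_augHuu e) (C.temperedArithmeticGroup e).isTempered Rq Sq) (BsFldHull.temperedFrobenioid_monoidType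 p C.augHuu (C.isOpen_map_augHuu e) (C.temperedArithmeticGroup e).isTempered Rq Sq) (BsFldHull.hP p C.augHuu (C.isOpen_map_augHuu e) (C.temperedArithmeticGroup e).isTempered Rq Sq) NH).C)
      (β : Ψ.functor.obj F.BN ≅ F.BN)
      (ΨbiratAut : F.biratUnits F.BN ≃* F.biratUnits F.BN)
      (Ψbs : ConnectedPart (BTemp (C.temperedArithmeticGroup e).Pi) ⥤ ConnectedPart (BTemp (C.temperedArithmeticGroup e).Pi))
      [Ψbs.Faithful]
      (eΨ : Ψ.functor ⋙ F.base ≅ F.base ⋙ Ψbs)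
      (hsq : ∀ u : F.units F.BN,
        ∀ hu : F.psiAut Ψ β u ∈ F.units F.BN, ΨbiratAut (F.unitsToBirat F.BN u) = F.unitsToBirat F.BN ⟨_, hu⟩)
      (hΨconst : F.constEmb.range.map ΨbiratAut.toMonoidHom = F.constEmb.range)
      (αA : Ψ.functor.obj F.AN ≅ F.AN)
      (eA : F.AN ≅ F.AN)
      (Dc Dp : Aut F.BN)
      (hRT : F.RootTransportWith Ψ αA β eA Dc Dp)
      (θA : Aut (F.base.obj F.BN) ≃* Aut (F.base.obj F.BN))
      (hST : F.StrvTransport Ψ αA eA θA)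
      (hθY : F.imPiY.map θA.toMonoidHom = F.imPiY)
      (hθYdd : F.HB.map θA.toMonoidHom = F.HB)
      (ψY : F.PiX ≃ₜ* F.PiX)
      (hbase : ∀ g, F.autBase F.BN (F.psiAut Ψ β (F.sgpCap (F.ρ g))) = F.ρ (ψY g))
      (hψY : F.PiY.map ψY.toMulEquiv.toMonoidHom = F.PiY)
      (hψYdd : F.PiYdd.map ψY.toMulEquiv.toMonoidHom = F.PiYdd),
      F.PsiAutPreserves Ψ β ΨbiratAut ∧
        F.MonoThetaEnvCompat
          H.sectionsFactor
          F.outerActionLZ_of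
          H.sgpCapSection
          H.sgpCupSection
          H.constantsEqNormalizer
          DK
          Ψ β ψY hbase hψY hψYdd := by
  intro F hconst m hD H DK
  exact thm510_ii_iii_ofThetaSettingYdd_of_isTopCharacteristic_canonical μ hC hS (BsFldHull.hypotheses p C.augHuu (C.isOpen_map_augHuu e) (C.temperedArithmeticGroup e).isTempered Rq Sq) Q Rt (D.K)
    (BsFldHull.constEmb p C.augHuu (C.isOpen_map_augHuu e) D.K augHuu_mem_fixingSubgroup (C.temperedArithmeticGroup e).isTempered Rq Sq Rt.BN)
    (BsFldHull.constEmb_injective p C.augHuu (C.isOpen_map_augHuu e) D.K augHuu_mem_fixingSubgroup (C.temperedArithmeticGroup e).isTempered Rq Sq Rt.BN) hinvc hinvp hconst m hD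

end HullThm510

end ThetaFrobenioid

end Literature.AnabelianGeometry.EtaleTheta

end
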